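/-
Copyright (c) 2026 the pub-hodgecm-mathlib formalisation cell (harness21).  Prover seat hodgecm-mathlib-LA3-p01 (g0), P6 «MOD programme», half A line L3 (ROOF road),
organ **(λ-transport)** for the `Roof₀` middle (LA3-plan RULING «DUAL-B̄» #5 (D) «lamB stays yours», 2026-09-02); 2026-09-02.
-/
import Literature.AlgebraicGeometry.AbelianSchemes.DualPairTransportAlongIso
import Literature.AlgebraicGeometry.AbelianSchemes.AbelianSchemeDualIsogenyComp
import Literature.AlgebraicGeometry.AbelianSchemes.AbelianSchemeQuotientPolarizationIdentity   -- ★ `dualIsogenyOver_congr`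
import HarnessLib

/-!
# THE ROOF MIDDLE ALONG A CLASS-INVARIANCE ISOMORPHISM: THE TRANSPORTED `λ` AND THE TRANSPORTED UNIT CLAUSE
# ([MumfordAV1970] §15 Thm. 1, §23; [MumfordFogartyKirwan1994] Ch. 7 §2 Def. 7.3; [MilneAV2008] I §8)

Topic `AlgebraicGeometry/AbelianSchemes`, namespace `Literature.AlgebraicGeometry.AbelianSchemes.AbelianSchemeOver`.  THEOREMS ONLY (no definition, no named fact, no
instance, no notation).  Cell `hodgecm-mathlib` (D-0151), F0∕P6 «MOD», line L3, socket `stub_ROOF0`∕`stub_ROOFGEO`: the middle `B̄` of Defs `Roof₀` receives its dual pair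
by ★ `DualPair.ofIso` (p848945) from the engine quotient `Q` along the class-invariance isomorphism `E : Q ≅ B̄` (RULING #5 (A)(B)); this file supplies the two rows of
`Roof₀` that must then be READ THROUGH `E`: (r3₀) the polarisation `λ_B̄ := E⁻¹ ≫ λ_Q` and the `J12` unit clause.
* `conj_comp_inv_comp_lam_comp_dualIsogenyOver_ofIso` — for homomorphisms `q : A → Q`, `c : A → B̄`, an isomorphism `E` WITH THE SQUARE `σ ≫ q ≫ E = τ ≫ c`
  (`σ = ι(s)`, `τ = ι(t)`, `s𝔟 = t𝔭`: the compatibility ★ KER-EQ delivers), and `λ_Q` with pull-back law `q ≫ λ_Q ≫ q^∨ = λ ≫ M`: **`τ ≫ (c ≫ λ_B̄ ≫ c^∨) ≫ τ^∨ =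
  σ ≫ λ ≫ M ≫ σ^∨`** (`c^∨` for `D_Q.ofIso E` is `(c ≫ E⁻¹)^∨`, ★ `dualIsogenyOver_ofIso_right`; `(ψ ≫ χ)^∨ = χ^∨ ≫ ψ^∨`, ★ `dualIsogenyOver_comp`) — the consumer
  finishes (r3₀) with the Rosati rows for `σ, τ` and right-cancellation of `τ` (★ `AbelianSchemeHomDescentPolarized` §1);
* `nonempty_pullback_unitHatSlice_ofIso_iso` — the unit clause `𝒫|_{B × {ε}} ≅ 𝒪` of `D_Q.ofIso E` from that of `D_Q` (square of slices `(B × {ε}) ≫ (E⁻¹ × 1) = E⁻¹ ≫ (Q × {ε})`,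
  pull-back of `𝒪` is `𝒪`).

HONEST LABEL: HC_CM is proved only modulo the cell's 2 remaining named inputs (hLiu418 24832, h413 24833) until rung 0 closes; generic capital on
`--supports stmt-HodgeConjecture-24832`, pays no letter.

## References
* [MumfordAV1970] D. Mumford, *Abelian Varieties* (1970), §15 Thm. 1 (p. 143), §23 (p. 231).
* [MumfordFogartyKirwan1994] D. Mumford, J. Fogarty, F. Kirwan, *GIT*, 3rd ed., Ch. 6 §1 Cor. 6.8 (p. 118), Ch. 7 §2 Definition 7.3 (p. 130).
* [MilneAV2008] J. S. Milne, *Abelian Varieties* (2008), I §8 pp. 36–37, I §9 Thm. 9.1 (p. 42).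
-/

set_option autoImplicit false

noncomputable section

universe u

open CategoryTheory CategoryTheory.Limits AlgebraicGeometry MonoidalCategory CartesianMonoidalCategory
open scoped MonObj

namespace Literature.AlgebraicGeometry.AbelianSchemes

namespace AbelianSchemeOver

variable {S : Scheme.{u}} {A Q B : AbelianSchemeOver S}

/-- **THE PULL-BACK OF THE TRANSPORTED `λ_Q` ALONG THE OTHER LEG, CONJUGATED.**  `q : A → Q`, `c : A → B` homomorphisms, `E : Q ≅ B` an isomorphism with the SQUARE
`σ ≫ q ≫ E = τ ≫ c` for endomorphisms `σ, τ` of `A` (e.g. `ι(s)`, `ι(t)` with `s𝔟 = t𝔭`); dual pairs `D_A`, `D_Q` and the transported `D_B := D_Q.ofIso E` (★); a homomorphism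
`λ_Q : Q → Q̂` with pull-back law `q ≫ λ_Q ≫ q^∨ = λ ≫ M` along `q`.  THEN the homomorphism `λ_B := E⁻¹ ≫ λ_Q : B → B̂ = Q̂` has, along `c` and after conjugation by `τ`,
the pull-back `τ ≫ (c ≫ λ_B ≫ c^∨) ≫ τ^∨ = σ ≫ (λ ≫ M) ≫ σ^∨` (`c^∨` for `D_B` is `(c ≫ E⁻¹)^∨` for `D_Q`, ★ `dualIsogenyOver_ofIso_right`; `(ψ ≫ χ)^∨ = χ^∨ ≫ ψ^∨`, ★
`dualIsogenyOver_comp`).  [cite: MumfordAV1970, §15 Thm. 1 (p. 143)] [cite: MumfordFogartyKirwan1994, Ch. 7 §2 Definition 7.3 (p. 130)] -/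
theorem conj_comp_inv_comp_lam_comp_dualIsogenyOver_ofIso
    (q : A.X ⟶ Q.X) [IsMonHom q] (c : A.X ⟶ B.X) [IsMonHom c] (E : Q.X ≅ B.X) [IsMonHom E.hom]
    (σ τ : A.X ⟶ A.X) [IsMonHom σ] [IsMonHom τ] (hsq : σ ≫ q ≫ E.hom = τ ≫ c)
    (DA : A.DualPair) (DQ : Q.DualPair) (lamQ : Q.X ⟶ DQ.hat.X) (lam : A.X ⟶ DA.hat.X) (M : DA.hat.X ⟶ DA.hat.X)
    (hq : q ≫ lamQ ≫ DualPair.dualIsogenyOver q DA DQ = lam ≫ M) :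
    τ ≫ (c ≫ (E.inv ≫ lamQ) ≫ DualPair.dualIsogenyOver c DA (DQ.ofIso E)) ≫ DualPair.dualIsogenyOver τ DA DA =
      σ ≫ (lam ≫ M) ≫ DualPair.dualIsogenyOver σ DA DA := by
  have h1 : τ ≫ c ≫ E.inv = σ ≫ q := by
    rw [← Category.assoc, ← hsq, Category.assoc, Category.assoc, Iso.hom_inv_id, Category.comp_id]
  have h2 : DualPair.dualIsogenyOver (c ≫ E.inv) DA DQ ≫ DualPair.dualIsogenyOver τ DA DA = DualPair.dualIsogenyOver (τ ≫ c ≫ E.inv) DA DQ :=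
    (DualPair.dualIsogenyOver_comp τ (c ≫ E.inv) DA DA DQ).symm
  have h3 : DualPair.dualIsogenyOver (τ ≫ c ≫ E.inv) DA DQ = DualPair.dualIsogenyOver (σ ≫ q) DA DQ := DualPair.dualIsogenyOver_congr DA DQ h1
  have h4 : DualPair.dualIsogenyOver (σ ≫ q) DA DQ = DualPair.dualIsogenyOver q DA DQ ≫ DualPair.dualIsogenyOver σ DA DA :=
    DualPair.dualIsogenyOver_comp σ q DA DA DQ
  rw [DualPair.dualIsogenyOver_ofIso_right]
  simp only [Category.assoc]
  rw [h2, h3, h4, ← reassoc_of% hq, reassoc_of% h1]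

/-- **THE UNIT CLAUSE TRANSPORTS** (the `J12` pin of Defs `Roof₀` for `D_B := D_Q.ofIso E`): if the Poincaré sheaf of `D_Q` is trivial along the slice `Q × {ε_Q̂}`, then the
transported Poincaré sheaf `(E⁻¹ × 1)^*𝒫_Q` of `D_Q.ofIso E` is trivial along `B × {ε_Q̂}` — the slices form the square `(B × {ε}) ≫ (E⁻¹ × 1) = E⁻¹ ≫ (Q × {ε})` and the
pull-back of `𝒪` is `𝒪`. [cite: MilneAV2008, I §8 pp. 36–37] [cite: MumfordFogartyKirwan1994, Ch. 7 §2 Definition 7.3 (p. 130)] -/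
theorem nonempty_pullback_unitHatSlice_ofIso_iso (E : Q.X ≅ B.X) [IsMonHom E.hom] (DQ : Q.DualPair)
    (hDQ : Nonempty ((Scheme.Modules.pullback (DualPair.unitHatSlice DQ)).obj DQ.P ≅ SheafOfModules.unit _)) :
    Nonempty ((Scheme.Modules.pullback (DualPair.unitHatSlice (DQ.ofIso E))).obj (DQ.ofIso E).P ≅ SheafOfModules.unit _) := by
  -- the square of slices
  have hsq : DualPair.unitHatSlice (DQ.ofIso E) ≫ DualPair.transportMap DQ E = E.inv.left ≫ DualPair.unitHatSlice DQ := by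
    have e1 : DualPair.transportMap DQ E ≫ pullback.fst Q.X.hom DQ.hat.X.hom = pullback.fst B.X.hom DQ.hat.X.hom ≫ E.inv.left :=
      DualPair.transportMap_fst DQ E
    have e1' : DualPair.transportMap DQ E ≫ pullback.snd Q.X.hom DQ.hat.X.hom = pullback.snd B.X.hom DQ.hat.X.hom :=
      DualPair.transportMap_snd DQ E
    have e2 : DualPair.unitHatSlice (DQ.ofIso E) ≫ pullback.fst B.X.hom DQ.hat.X.hom = 𝟙 _ := DualPair.unitHatSlice_fst (DQ.ofIso E)
    have e2' : DualPair.unitHatSlice (DQ.ofIso E) ≫ pullback.snd B.X.hom DQ.hat.X.hom = B.X.hom ≫ DQ.hat.unitSection :=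
      DualPair.unitHatSlice_snd (DQ.ofIso E)
    have e3 : DualPair.unitHatSlice DQ ≫ pullback.fst Q.X.hom DQ.hat.X.hom = 𝟙 _ := DualPair.unitHatSlice_fst DQ
    have e3' : DualPair.unitHatSlice DQ ≫ pullback.snd Q.X.hom DQ.hat.X.hom = Q.X.hom ≫ DQ.hat.unitSection := DualPair.unitHatSlice_snd DQ
    have w : E.inv.left ≫ Q.X.hom = B.X.hom := Over.w E.inv
    apply pullback.hom_ext
    · exact ((Category.assoc _ _ _).trans ((congrArg (DualPair.unitHatSlice (DQ.ofIso E) ≫ ·) e1).trans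
        ((Category.assoc _ _ _).symm.trans ((congrArg (· ≫ E.inv.left) e2).trans (Category.id_comp _))))).trans
        ((Category.assoc _ _ _).trans ((congrArg (E.inv.left ≫ ·) e3).trans (Category.comp_id _))).symm
    · exact ((Category.assoc _ _ _).trans ((congrArg (DualPair.unitHatSlice (DQ.ofIso E) ≫ ·) e1').trans e2')).trans
        ((Category.assoc _ _ _).trans ((congrArg (E.inv.left ≫ ·) e3').trans ((Category.assoc _ _ _).symm.trans
          (congrArg (· ≫ DQ.hat.unitSection) w)))).symm
  -- the pull-back of `𝒪` along `E⁻¹` is `𝒪`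
  have hI : IsIso (SheafOfModules.pullbackObjUnitToUnit E.inv.left.toRingCatSheafHom) := by
    haveI := Literature.AlgebraicGeometry.KTheory.final_opensMap E.inv.left
    exact SheafOfModules.instIsIsoPullbackObjUnitToUnitOfFinal _
  obtain ⟨r⟩ := hDQ
  exact ⟨(Scheme.Modules.pullbackComp _ _).app DQ.P ≪≫ (Scheme.Modules.pullbackCongr hsq).app DQ.P ≪≫
    ((Scheme.Modules.pullbackComp _ _).app DQ.P).symm ≪≫ (Scheme.Modules.pullback E.inv.left).mapIso r ≪≫
    @asIso _ _ _ _ (SheafOfModules.pullbackObjUnitToUnit E.inv.left.toRingCatSheafHom) hI⟩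

end AbelianSchemeOver

end Literature.AlgebraicGeometry.AbelianSchemes

end
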